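import Summits.ABC.ABC.Theorems.TwistAmplificationSharpModerateLawCuspTransferCone
import Summits.ABC.ABC.Theorems.TwistAmplificationSharpModerateLawSyzygyTransferCone
import Summits.ABC.ABC.Theorems.TwistAmplificationSharpModerateLawLatticeHalf
import Summits.ABC.ABC.Theorems.TwistAmplificationSharpModerateLawFieldSum
import Summits.ABC.ABC.Theorems.TwistAmplificationSharpModerateLawFewDeepOfLattice
import Summits.ABC.ABC.Theorems.TwistAmplificationSharpModerateLawUniformityDischarge

/-!
# Line `syzygy-lattice-half-deep-few-primes` — skeleton v8 for crux `SharpModerateLaw` (stmt-ABC-1975)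

v8 (courtesy update by the crux's current lead `prover-line-stmt-ABC-1975-c4-0`, seated on the sibling line `unit-plane-conic-two-torsion`,
2026-08-16 22:40Z; NOT re-registered — the live registry is the unit-plane v4.1 stub set): `stub_uniformity` is DISCHARGED — BTT 2023 Prop. 4.5 is the
tree theorem `Literature.NumberTheory.CubicFields.btt_uniformity_sqDvd_holds` (19:56Z) and the stub, by this name and signature, is the landed
`Summit.ABC.ABC.Theorems.SharpModerateLaw.stub_uniformity` (`…UniformityDischarge.lean`, p127390), imported above (so it is no longer declared here).
Hence ONE `sorry` remains, the open core `stub_spreadCensusCone : SpreadLawCone`, and the tree proves unconditionally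
`sharpModerateLaw_of_spreadLawCone : SpreadLawCone → SharpModerateLaw`, `fewDeepLaw_holds`, `fieldSum_holds` (p127390), the residue identity with the
sibling line `UnitPlane.residue_iff_spreadLawCone : (LawWithConeE SpreadDeep6 1 ∧ RingCensus6 ∧ CornerHallLaw6) ↔ SpreadLawCone` (p127390), and
`abc_of_spreadLawCone : SpreadLawCone → ABC`, `cuspLawD_of_spreadLawCone`, `lawOn_of_spreadLawCone` (census core ⇒ the dispersion line's cores ⇒ summit;
p128832, `…CensusToDispersion.lean`).

v7 (lead `prover-line-stmt-ABC-1975-0`, 2026-08-16).  Everything provable on this line has LANDED and is imported above: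

* `stub_cuspTransfer : CuspShellLaw → SharpModerateLaw` (p74724) and its cone form `cuspTransferCone` (p76583);
* `stub_syzygyTransfer : IndexFormShellLaw → CuspShellLaw` (p75600) and its cone form `syzygyTransferCone`, with the cone
  split `indexFormShellLawCone_of_split` (p76848);
* `stub_latticeHalf : LatticeHalf` (Kane's lattice half uniformly in a maximal cubic form; 5-file chain);
* `stub_fewDeepOfLattice : LatticeHalf → FieldSum → FewDeepLaw` (3-file chain);
* `stub_fieldSum : btt_uniformity_sqDvd → FieldSum` (conditional on ONE named Literature fact; chain incl. two Literature files).

The composition below is (v8) a closed term over exactly ONE open registered stub (v7: two — `stub_uniformity`, now the landed theorem of that name, and):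
* `stub_spreadCensusCone : SpreadLawCone` — the crux's OPEN CORE in its honest minimal (cone-restricted) form: the dyadic law
  for the spread population of index-form data on the scales `X³ ≤ 2Y ≤ 2·186624·X^σ` only (`…ConeDefs.lean`); the previously
  registered two-parameter `SpreadLaw` implies it (`spreadLaw_implies_cone`, landed) and is not needed by the crux.
-/

noncomputable section

namespace Summit.ABC.ABC.Theorems.SharpModerateLaw

/-- **stub_spreadCensusCone** `SpreadLawCone` — the OPEN CORE of the crux on this line (cone-restricted spread law):
`∀ σ > 6, ∀ ε > 0, ∃ C, ∀ X Y ≥ 1, X³ ≤ 2Y → Y ≤ 186624·X^σ → totalCount (¬FewDeep) X Y ≤ C (XY)^ε (X·Y^{-1/6} + 1)`.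
Equivalent in strength to the crux on the spread population; no engine in print (candidates: Kane's conic half in maximal cubic
orders + Heath-Brown's sharp conic bound + Bhargava mean 2-torsion + a census of hit shapes; or dispersion over deep moduli at
level 6/5).  See the lead's analysis attached to the item. -/
theorem stub_spreadCensusCone : SpreadLawCone := by
  sorry

/-- **Composition (the skeleton theorem, v7/v8; `stub_uniformity` is now the landed theorem).** The crux BY NAME as a closed term: cone cusp transfer ∘ cone dictionary step ∘
cone split of (few-deep law from the lattice half and the field sum, the latter from the BTT uniformity fact) and the cone spread law. -/
theorem SharpModerateLaw_of : Summit.ABC.ABC.Theses.TwistAmplification.SharpModerateLaw :=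
  cuspTransferCone
    (syzygyTransferCone
      (indexFormShellLawCone_of_split
        (fewDeepLawCone_of_fewDeepLaw (stub_fewDeepOfLattice stub_latticeHalf (stub_fieldSum stub_uniformity)))
        stub_spreadCensusCone))

end Summit.ABC.ABC.Theorems.SharpModerateLaw

end
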